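import Summits.QuantumFields.YangMills.Theorems.BalabanUVNodesPortU8ImagesKernelRecord

/-!
# Port piece U8 — THE METHOD OF IMAGES, FILE 3: THE INFINITE-VOLUME BOUNDS OF THE FOUR STENCIL KERNELS, EXTRACTED FROM THE VOLUME-UNIFORM TORUS ROWS BY `M → ∞`
# (PORT-PLAN-v4 §3): `|Re 𝒦(a + n·z)| ≤ C·η^j·e^{−δ|z|_∞}` for `𝒦 ∈ {imgKer, kerDiff, kerLap, kerCurl}`, `j ∈ {0, 1, 2, 2}`, all offsets `a`, all `z ∈ ℤ⁴`

Cell `ym-nodeO-ideate` ∕ `ym-balaban-port`, porter `ymgap-nodeO-port-PTB-1` (gen 5).  JOIN-side helper for **stmt-QuantumFields-27238** (K0ᴬ), `--supports … --as helper`.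
[B5] = [Balaban1984PropagatorsI], [B6] = [Balaban1984PropagatorsII], [15] = [Balaban1985Variational].

THE ARGUMENT ([B5] p. 36 ll. 20–23 «relating G on the torus to G on the whole lattice ηℤ^d in the usual way», read backwards).  Fix the block scale `n = L^{k+1}`, an offset `a`,
directions and `z ∈ ℤ⁴`.  On EVERY volume `K` of the family with `N_K = sitesPerDir (k+1) ≥ 2|z|_∞ + 1` the configuration «source site = class of `a + n·z`, label site `0`» realises
the stencil of `windowResp F k K univ` as the periodisation `P_{M_K}` of the real kernel `z ↦ Re 𝒦(a + n·z)` at `z` (file 2b), while the torus row bounds that stencil by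
`C·η^j·e^{−δ·|z|_{T,∞}} = C·η^j·e^{−δ|z|_∞}` (centred `z`); the rows being uniform in `K` and the tails of the periodisation vanishing as `N_K → ∞` (file 1,
`norm_le_of_forall_periodise_le`), the infinite-lattice kernel obeys the same bound.  No new symbol analysis: the inputs are the tree's PROVED rows ✓`norm_windowResp_univ_le`
(value; [B5] (1.63) via `B5Hk163Torus`), ✓`abs_windowResp_univ_shift_sub_le` (differences; `B5Hk163TorusHolderDecay`), ✓`abs_lapStencil_windowResp_univ_le` (Laplacian; p22's [B6]
(2.130)∕Prop. 2.5 row), ✓`abs_curlCurl_windowResp_univ_le` (curl; r03's [B6] (2.148)∕(2.150) rows).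

WHAT IS PROVED (kernel, sorry-free).
§1 realisation bookkeeping: `exists_volume_ge` (volumes with `N_K ≥ t + 1` and a spare level), `blk_offset_eq_zero`, `rep_zero_site`, `exists_rep_toT_eq_translate`,
   `iterBlockOf_symm_EK_toT` (the block of the realised source is the class of `z`), `torusSupNorm_realised` (`= |z|_∞` for centred `z`), `translate_fine_offset_zero`.
§2 crude decay + real parts: `norm_re_stencil_le_crude` family (summability side conditions of file 1).
§3 `norm_le_of_rows` (the generic extraction step at the record) and ★★★ `norm_re_imgKer_le` — the infinite-volume VALUE bound with the row's constants (`j = 0`), uniform in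
   `k`, the offset, the directions; the difference ∕ Laplacian ∕ curl bounds (`j = 1, 2, 2`) are the companion file `…ImagesInfVolStencils` (same template).

HONEST FRAMING.  Bookkeeping over PROVED tree theorems; no Bałaban estimate is asserted beyond what those rows prove; prepares the two-volume row (R4ᴰ)′ by images (files 4–5);
27931 CLOSED·IMPLICATION-ONLY·IN TOTO unchanged; K0ᴬ 27238 OPEN; NODE O 0∕1; COUNT 8∕28 · K 1∕4 UNMOVED; finite `𝕋⁴_{L^K}` at fixed ε — NOT continuum ∕ OS ∕ Clay; **the Yang–Mills mass gap
(Clay) is NOT proved.**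
-/

noncomputable section

open scoped BigOperators

namespace Summit.QuantumFields.YangMills.Theorems.PortU8.Images

open Literature.MathematicalPhysics.QuantumFieldTheory.Balaban1983to89
open Literature.MathematicalPhysics.QuantumFieldTheory.Balaban1983to89.T4Continuum (T4Family)
open Literature.MathematicalPhysics.QuantumFieldTheory.Balaban1983to89.B4ContourShift (latticeKernel supNorm exists_supNorm_eq abs_le_supNorm supNorm_nonneg)
open Literature.MathematicalPhysics.QuantumFieldTheory.Balaban1983to89.B4TorusKernel (periodConst)
open Literature.MathematicalPhysics.QuantumFieldTheory.Balaban1983to89.B4TorusKernel.MultiPeriod (translate translate_apply torusSupNorm torusSupNorm_translate torusSupNorm_of_centred)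
open Literature.MathematicalPhysics.QuantumFieldTheory.Balaban1983to89.B5Hk163Decay (G163 MG163 MG163_nonneg)
open Literature.MathematicalPhysics.QuantumFieldTheory.Balaban1983to89.B5Hk163Strip (kappa163 kappa163_pos)
open Literature.MathematicalPhysics.QuantumFieldTheory.Balaban1983to89.B5Prop11Plancherel (Tor fine)
open Literature.MathematicalPhysics.QuantumFieldTheory.Balaban1983to89.B5Block118 (bpt)
open Literature.MathematicalPhysics.QuantumFieldTheory.Balaban1983to89.B5Blocks16 (blockOf_bpt)
open Literature.MathematicalPhysics.QuantumFieldTheory.Balaban1983to89.B5Eq117TorusCarriers (Mk EK)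
open Literature.MathematicalPhysics.QuantumFieldTheory.Balaban1983to89.B5Eq118OneStroke (iterBlockOf)
open Literature.MathematicalPhysics.QuantumFieldTheory.Balaban1983to89.B6LowerBound2153Torus (toT rep toT_rep isPeriod_rep_toT_sub)
open Literature.MathematicalPhysics.QuantumFieldTheory.Balaban1983to89.B6BondElimination (unitVec unitVec_apply)
open Literature.MathematicalPhysics.QuantumFieldTheory.Balaban1983to89.B6BlockDecayHjCovV1 (blockOf_EK_eq_iterBlockOf)
open Summit.QuantumFields.YangMills.Theorems.K0RecordFormatNames

variable (F : T4Family)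

/-! ## §1  Realising `(a, z)` on a large volume of the family -/

/-- **Volumes with a large coarse torus**: for every `t` there is a volume `K` with one spare level above `k + 1` and `sitesPerDir (k+1) ≥ t + 1`. [folklore] -/
theorem exists_volume_ge (k t : ℕ) : ∃ K : ℕ, k + 1 + 1 ≤ (F.P K).m + (F.P K).K ∧ t + 1 ≤ (F.P K).sitesPerDir (k + 1) := by
  refine ⟨t + k + 2, ?_, ?_⟩
  · simp only [T4Family.P_m, T4Family.P_K]; omega
  · simp only [Params.sitesPerDir, T4Family.P_m, T4Family.P_K, T4Family.P_L]
    have hL : 2 ≤ F.L := F.hL.2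
    have h1 : t + 1 ≤ 2 ^ (t + 1) := Nat.lt_two_pow_self.le
    have h2 : 2 ^ (t + 1) ≤ F.L ^ (t + 1) := Nat.pow_le_pow_left hL _
    have h3 : F.L ^ (t + 1) ≤ F.L ^ (F.m + (t + k + 2) - (k + 1)) := Nat.pow_le_pow_right (by omega) (by omega)
    have h4 : F.L ^ (F.m + (t + k + 2) - (k + 1)) ≤ 2 * F.L ^ (F.m + (t + k + 2) - (k + 1)) := by omega
    omega

/-- An offset vector has block `0`. [cite: Balaban1984PropagatorsI, (1.18) p.20] -/
theorem blk_offset_eq_zero (n : ℕ) [NeZero n] (a : Fin (3 + 1) → Fin n) : blk n (fun j => ((a j : ℕ) : ℤ)) = 0 := by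
  funext i
  have h0 : (0 : ℤ) ≤ ((a i : ℕ) : ℤ) := Int.natCast_nonneg _
  have h1 : ((a i : ℕ) : ℤ) < n := by exact_mod_cast (a i).isLt
  simp only [blk, Pi.zero_apply]
  exact Int.ediv_eq_zero_of_lt h0 h1

/-- The offset of an offset vector is itself. [cite: Balaban1984PropagatorsI, (1.18) p.20] -/
theorem off_offset_eq (n : ℕ) [NeZero n] (a : Fin (3 + 1) → Fin n) : off n (fun j => ((a j : ℕ) : ℤ)) = a := by
  funext i
  apply Fin.ext
  have h0 : (0 : ℤ) ≤ ((a i : ℕ) : ℤ) := Int.natCast_nonneg _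
  have h1 : ((a i : ℕ) : ℤ) < n := by exact_mod_cast (a i).isLt
  simp only [off, Int.emod_eq_of_lt h0 h1, Int.toNat_natCast]

/-- The representative of the origin is `0`. [folklore] -/
theorem rep_zero_site {K : ℕ} (j : ℕ) : rep (Mk (F.P K) j) (0 : Site (F.P K) j) = 0 := by
  funext i
  have h0 : (0 : Site (F.P K) j) i = 0 := rfl
  simp only [rep, h0, ZMod.val_zero, Nat.cast_zero, Pi.zero_apply]

/-- The representative of the origin is `0` (dimension written `3 + 1`). [folklore] -/
theorem rep_zero_site' {K : ℕ} (j : ℕ) : rep (d := 3 + 1) (Mk (F.P K) j) (0 : Site (F.P K) j) = 0 := by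
  funext i
  have h0 : (0 : Site (F.P K) j) i = 0 := rfl
  simp only [rep, h0, ZMod.val_zero, Nat.cast_zero, Pi.zero_apply]

/-- The box representative of the class of `z` is a period translate of `z`. [folklore] -/
theorem exists_rep_toT_eq_translate {d : ℕ} (M : Fin (d + 1) → ℕ) [∀ μ, NeZero (M μ)] (z : Fin (d + 1) → ℤ) :
    ∃ m : Fin (d + 1) → ℤ, rep M (toT M z) = translate M z m := by
  have h := isPeriod_rep_toT_sub M z
  choose m hm using h
  refine ⟨m, funext fun i => ?_⟩
  have := hm i
  simp only [Pi.sub_apply] at this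
  rw [translate_apply]
  linarith

/-- The fine-period translate of `a + n·z` is `a + n·(z + M∘m)`. [folklore] -/
theorem translate_fine_offset (n : ℕ) (M : Fin (3 + 1) → ℕ) (a z m : Fin (3 + 1) → ℤ) :
    translate (fine n M) (a + (n : ℤ) • z - (n : ℤ) • (0 : Fin (3 + 1) → ℤ)) m = a + (n : ℤ) • translate M z m := by
  funext i
  simp only [translate_apply, Pi.add_apply, Pi.sub_apply, Pi.smul_apply, Pi.zero_apply, smul_eq_mul, fine]
  push_cast; ring

variable {F}

/-- **THE REALISED CONFIGURATION**: on the volume `K` (spare level `hk2`), the source site `x := EK⁻¹[a + n·z]` and the label site `0` have: class of `a + n·z` = `EK x`; the block of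
`x` is the class of `z`, so for centred `z` the torus distance from the block of `x` to the label is `|z|_∞`. [cite: Balaban1984PropagatorsI, (1.18) p.20] -/
theorem realised_config {k K : ℕ} (hk2 : k + 1 + 1 ≤ (F.P K).m + (F.P K).K) (a : Fin (3 + 1) → Fin ((F.P K).L ^ (k + 1))) (z : Fin (3 + 1) → ℤ)
    (hz : ∀ i, 2 * |z i| ≤ Mk (F.P K) (k + 1) i) :
    ∃ x : Site (F.P K) 0,
      toT (d := 3 + 1) (fine (d := 3 + 1) ((F.P K).L ^ (k + 1)) (Mk (F.P K) (k + 1))) ((fun j => ((a j : ℕ) : ℤ)) + (((F.P K).L ^ (k + 1) : ℕ) : ℤ) • z) =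
        EK (Nat.le_of_succ_le hk2) x ∧
      torusSupNorm (Mk (F.P K) (k + 1)) (rep (Mk (F.P K) (k + 1)) (iterBlockOf (k + 1) x) - rep (Mk (F.P K) (k + 1)) (0 : Site (F.P K) (k + 1))) =
        supNorm z := by
  have hk : k + 1 ≤ (F.P K).m + (F.P K).K := Nat.le_of_succ_le hk2
  refine ⟨(EK hk).symm (toT (d := 3 + 1) (fine (d := 3 + 1) ((F.P K).L ^ (k + 1)) (Mk (F.P K) (k + 1)))
    ((fun j => ((a j : ℕ) : ℤ)) + (((F.P K).L ^ (k + 1) : ℕ) : ℤ) • z)), ((EK hk).apply_symm_apply _).symm, ?_⟩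
  -- the block of the realised source is the class of `z`
  have h1 := blockOf_EK_eq_iterBlockOf hk ((EK hk).symm (toT (d := 3 + 1) (fine (d := 3 + 1) ((F.P K).L ^ (k + 1)) (Mk (F.P K) (k + 1)))
      ((fun j => ((a j : ℕ) : ℤ)) + (((F.P K).L ^ (k + 1) : ℕ) : ℤ) • z)))
  have h2 : EK hk ((EK hk).symm (toT (d := 3 + 1) (fine (d := 3 + 1) ((F.P K).L ^ (k + 1)) (Mk (F.P K) (k + 1)))
      ((fun j => ((a j : ℕ) : ℤ)) + (((F.P K).L ^ (k + 1) : ℕ) : ℤ) • z))) =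
      bpt ((F.P K).L ^ (k + 1)) (Mk (F.P K) (k + 1)) (toT (d := 3 + 1) (Mk (F.P K) (k + 1)) z)
        (off ((F.P K).L ^ (k + 1)) ((fun j => ((a j : ℕ) : ℤ)) + (((F.P K).L ^ (k + 1) : ℕ) : ℤ) • z)) := by
    rw [Equiv.apply_symm_apply, toT_fine_eq_bpt, blk_add_nsmul, blk_offset_eq_zero, zero_add]
    rfl
  have h3 := blockOf_bpt ((F.P K).L ^ (k + 1)) (Mk (F.P K) (k + 1)) (toT (d := 3 + 1) (Mk (F.P K) (k + 1)) z)
    (off ((F.P K).L ^ (k + 1)) ((fun j => ((a j : ℕ) : ℤ)) + (((F.P K).L ^ (k + 1) : ℕ) : ℤ) • z))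
  rw [h2] at h1
  have hblk : iterBlockOf (k + 1) ((EK hk).symm (toT (d := 3 + 1) (fine (d := 3 + 1) ((F.P K).L ^ (k + 1)) (Mk (F.P K) (k + 1)))
      ((fun j => ((a j : ℕ) : ℤ)) + (((F.P K).L ^ (k + 1) : ℕ) : ℤ) • z))) = toT (d := 3 + 1) (Mk (F.P K) (k + 1)) z :=
    h1.symm.trans h3
  rw [hblk, rep_zero_site, sub_zero]
  obtain ⟨m, hm⟩ := exists_rep_toT_eq_translate (d := 3) (Mk (F.P K) (k + 1)) z
  have h4 : torusSupNorm (Mk (F.P K) (k + 1)) (rep (d := 3 + 1) (Mk (F.P K) (k + 1)) (toT (d := 3 + 1) (Mk (F.P K) (k + 1)) z)) = supNorm z := by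
    rw [hm, torusSupNorm_translate, torusSupNorm_of_centred (one_le_Mk F K (k + 1)) hz]
  exact h4

/-! ## §2  The four real kernels at an offset: crude decay (for the tails) -/

section Crude

variable (n : ℕ) [NeZero n] (μ lam : Fin (3 + 1)) (a : Fin (3 + 1) → Fin n)

/-- Crude decay of `Re imgKer (a + n·z)`. [cite: Balaban1984PropagatorsI, (1.65) p.29] -/
theorem norm_re_imgKer_crude (z : Fin (3 + 1) → ℤ) :
    ‖(((imgKer n μ lam ((fun j => ((a j : ℕ) : ℤ)) + (n : ℤ) • z)).re : ℝ) : ℂ)‖ ≤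
      MG163 (3 + 1) * Real.exp (2 * kappa163 (3 + 1)) * Real.exp (-(kappa163 (3 + 1) * supNorm z)) := by
  refine (norm_re_le_of_norm_le (K := fun z => imgKer n μ lam ((fun j => ((a j : ℕ) : ℤ)) + (n : ℤ) • z)) (fun y => ?_) z)
  have h := norm_imgKer_offset_le n μ lam a y 0 abs_zero_step_le
  rwa [add_zero] at h

/-- Crude decay of `Re kerDiff (a + n·z)`. [cite: Balaban1984PropagatorsI, (1.65) p.29] -/
theorem norm_re_kerDiff_crude (ν : Fin (3 + 1)) (z : Fin (3 + 1) → ℤ) :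
    ‖(((kerDiff n μ lam ν ((fun j => ((a j : ℕ) : ℤ)) + (n : ℤ) • z)).re : ℝ) : ℂ)‖ ≤
      2 * (MG163 (3 + 1) * Real.exp (2 * kappa163 (3 + 1))) * Real.exp (-(kappa163 (3 + 1) * supNorm z)) := by
  refine (norm_re_le_of_norm_le (K := fun z => kerDiff n μ lam ν ((fun j => ((a j : ℕ) : ℤ)) + (n : ℤ) • z)) (fun y => ?_) z)
  have h1 := norm_imgKer_offset_le n μ lam a y (unitVec ν) (fun i => (abs_unitVec_le ν i).1)
  have h0 := norm_imgKer_offset_le n μ lam a y 0 abs_zero_step_le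
  rw [add_zero] at h0
  calc ‖kerDiff n μ lam ν ((fun j => ((a j : ℕ) : ℤ)) + (n : ℤ) • y)‖ ≤ _ + _ := norm_sub_le _ _
    _ ≤ _ := by linarith

/-- Crude decay of `Re kerLap (a + n·z)`. [cite: Balaban1984PropagatorsI, (1.65) p.29] -/
theorem norm_re_kerLap_crude (z : Fin (3 + 1) → ℤ) :
    ‖(((kerLap n μ lam ((fun j => ((a j : ℕ) : ℤ)) + (n : ℤ) • z)).re : ℝ) : ℂ)‖ ≤
      (3 + 1 : ℕ) * (4 * (MG163 (3 + 1) * Real.exp (2 * kappa163 (3 + 1)))) * Real.exp (-(kappa163 (3 + 1) * supNorm z)) := by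
  refine (norm_re_le_of_norm_le (K := fun z => kerLap n μ lam ((fun j => ((a j : ℕ) : ℤ)) + (n : ℤ) • z)) (fun y => ?_) z)
  set E := MG163 (3 + 1) * Real.exp (2 * kappa163 (3 + 1)) * Real.exp (-(kappa163 (3 + 1) * supNorm y)) with hE
  have hterm : ∀ ν : Fin (3 + 1), ‖imgKer n μ lam ((fun j => ((a j : ℕ) : ℤ)) + (n : ℤ) • y + unitVec ν) -
      2 * imgKer n μ lam ((fun j => ((a j : ℕ) : ℤ)) + (n : ℤ) • y) + imgKer n μ lam ((fun j => ((a j : ℕ) : ℤ)) + (n : ℤ) • y - unitVec ν)‖ ≤ 4 * E := by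
    intro ν
    have h1 := norm_imgKer_offset_le n μ lam a y (unitVec ν) (fun i => (abs_unitVec_le ν i).1)
    have h0 := norm_imgKer_offset_le n μ lam a y 0 abs_zero_step_le
    have h2 := norm_imgKer_offset_le n μ lam a y (-unitVec ν) (fun i => (abs_unitVec_le ν i).2)
    rw [add_zero] at h0
    rw [← sub_eq_add_neg] at h2
    have h3 : ‖(2 : ℂ) * imgKer n μ lam ((fun j => ((a j : ℕ) : ℤ)) + (n : ℤ) • y)‖ ≤ 2 * E := by
      rw [norm_mul, Complex.norm_ofNat]; linarith
    calc _ ≤ ‖imgKer n μ lam ((fun j => ((a j : ℕ) : ℤ)) + (n : ℤ) • y + unitVec ν) - 2 * imgKer n μ lam ((fun j => ((a j : ℕ) : ℤ)) + (n : ℤ) • y)‖ +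
          ‖imgKer n μ lam ((fun j => ((a j : ℕ) : ℤ)) + (n : ℤ) • y - unitVec ν)‖ := norm_add_le _ _
      _ ≤ (‖imgKer n μ lam ((fun j => ((a j : ℕ) : ℤ)) + (n : ℤ) • y + unitVec ν)‖ + ‖(2 : ℂ) * imgKer n μ lam ((fun j => ((a j : ℕ) : ℤ)) + (n : ℤ) • y)‖) +
          ‖imgKer n μ lam ((fun j => ((a j : ℕ) : ℤ)) + (n : ℤ) • y - unitVec ν)‖ := by gcongr; exact norm_sub_le _ _
      _ ≤ 4 * E := by linarith
  calc ‖kerLap n μ lam ((fun j => ((a j : ℕ) : ℤ)) + (n : ℤ) • y)‖ ≤ ∑ ν : Fin (3 + 1), 4 * E := norm_sum_le_of_le _ fun ν _ => hterm ν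
    _ = (3 + 1 : ℕ) * (4 * (MG163 (3 + 1) * Real.exp (2 * kappa163 (3 + 1)))) * Real.exp (-(kappa163 (3 + 1) * supNorm y)) := by
        rw [Finset.sum_const, Finset.card_univ, Fintype.card_fin, nsmul_eq_mul, hE]; push_cast; ring

/-- Crude decay of `Re kerCurl (a + n·z)`. [cite: Balaban1984PropagatorsI, (1.65) p.29] -/
theorem norm_re_kerCurl_crude (z : Fin (3 + 1) → ℤ) :
    ‖(((kerCurl n μ lam ((fun j => ((a j : ℕ) : ℤ)) + (n : ℤ) • z)).re : ℝ) : ℂ)‖ ≤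
      (3 + 1 : ℕ) * (8 * (MG163 (3 + 1) * Real.exp (2 * kappa163 (3 + 1)))) * Real.exp (-(kappa163 (3 + 1) * supNorm z)) := by
  refine (norm_re_le_of_norm_le (K := fun z => kerCurl n μ lam ((fun j => ((a j : ℕ) : ℤ)) + (n : ℤ) • z)) (fun y => ?_) z)
  set E := MG163 (3 + 1) * Real.exp (2 * kappa163 (3 + 1)) * Real.exp (-(kappa163 (3 + 1) * supNorm y)) with hE
  have hb : ∀ (μ' : Fin (3 + 1)) (s : Fin (3 + 1) → ℤ), (∀ i, |s i| ≤ 2) → ‖imgKer n μ' lam ((fun j => ((a j : ℕ) : ℤ)) + (n : ℤ) • y + s)‖ ≤ E :=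
    fun μ' s hs => norm_imgKer_offset_le n μ' lam a y s hs
  have s0 : ∀ i : Fin (3 + 1), |(0 : Fin (3 + 1) → ℤ) i| ≤ 2 := abs_zero_step_le
  have hterm : ∀ ν : Fin (3 + 1),
      ‖(imgKer n μ lam ((fun j => ((a j : ℕ) : ℤ)) + (n : ℤ) • y) + imgKer n ν lam ((fun j => ((a j : ℕ) : ℤ)) + (n : ℤ) • y + unitVec μ) -
          imgKer n μ lam ((fun j => ((a j : ℕ) : ℤ)) + (n : ℤ) • y + unitVec ν) - imgKer n ν lam ((fun j => ((a j : ℕ) : ℤ)) + (n : ℤ) • y)) -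
        (imgKer n μ lam ((fun j => ((a j : ℕ) : ℤ)) + (n : ℤ) • y - unitVec ν) +
            imgKer n ν lam ((fun j => ((a j : ℕ) : ℤ)) + (n : ℤ) • y - unitVec ν + unitVec μ) -
          imgKer n μ lam ((fun j => ((a j : ℕ) : ℤ)) + (n : ℤ) • y - unitVec ν + unitVec ν) - imgKer n ν lam ((fun j => ((a j : ℕ) : ℤ)) + (n : ℤ) • y - unitVec ν))‖ ≤
        8 * E := by
    intro ν
    have e0 : (fun j => ((a j : ℕ) : ℤ)) + (n : ℤ) • y = (fun j => ((a j : ℕ) : ℤ)) + (n : ℤ) • y + 0 := (add_zero _).symm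
    have h1 : ‖imgKer n μ lam ((fun j => ((a j : ℕ) : ℤ)) + (n : ℤ) • y)‖ ≤ E := by rw [e0]; exact hb μ 0 s0
    have h2 := hb ν (unitVec μ) (fun i => (abs_unitVec_le μ i).1)
    have h3 := hb μ (unitVec ν) (fun i => (abs_unitVec_le ν i).1)
    have h4 : ‖imgKer n ν lam ((fun j => ((a j : ℕ) : ℤ)) + (n : ℤ) • y)‖ ≤ E := by rw [e0]; exact hb ν 0 s0
    have h5 : ‖imgKer n μ lam ((fun j => ((a j : ℕ) : ℤ)) + (n : ℤ) • y - unitVec ν)‖ ≤ E := by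
      rw [sub_eq_add_neg]; exact hb μ _ (fun i => (abs_unitVec_le ν i).2)
    have h6 : ‖imgKer n ν lam ((fun j => ((a j : ℕ) : ℤ)) + (n : ℤ) • y - unitVec ν + unitVec μ)‖ ≤ E := by
      rw [sub_eq_add_neg, add_assoc]; exact hb ν _ (fun i => (abs_unitVec_add_le ν μ i).1)
    have h7 : ‖imgKer n μ lam ((fun j => ((a j : ℕ) : ℤ)) + (n : ℤ) • y - unitVec ν + unitVec ν)‖ ≤ E := by
      rw [sub_eq_add_neg, add_assoc]; exact hb μ _ (fun i => (abs_unitVec_add_le ν ν i).2)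
    have h8 : ‖imgKer n ν lam ((fun j => ((a j : ℕ) : ℤ)) + (n : ℤ) • y - unitVec ν)‖ ≤ E := by
      rw [sub_eq_add_neg]; exact hb ν _ (fun i => (abs_unitVec_le ν i).2)
    have hA := norm_sub_le
      (imgKer n μ lam ((fun j => ((a j : ℕ) : ℤ)) + (n : ℤ) • y) + imgKer n ν lam ((fun j => ((a j : ℕ) : ℤ)) + (n : ℤ) • y + unitVec μ) -
        imgKer n μ lam ((fun j => ((a j : ℕ) : ℤ)) + (n : ℤ) • y + unitVec ν) - imgKer n ν lam ((fun j => ((a j : ℕ) : ℤ)) + (n : ℤ) • y))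
      (imgKer n μ lam ((fun j => ((a j : ℕ) : ℤ)) + (n : ℤ) • y - unitVec ν) +
          imgKer n ν lam ((fun j => ((a j : ℕ) : ℤ)) + (n : ℤ) • y - unitVec ν + unitVec μ) -
        imgKer n μ lam ((fun j => ((a j : ℕ) : ℤ)) + (n : ℤ) • y - unitVec ν + unitVec ν) - imgKer n ν lam ((fun j => ((a j : ℕ) : ℤ)) + (n : ℤ) • y - unitVec ν))
    have hB : ∀ (p q r s : ℂ), ‖p + q - r - s‖ ≤ ‖p‖ + ‖q‖ + ‖r‖ + ‖s‖ := fun p q r s => by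
      calc ‖p + q - r - s‖ ≤ ‖p + q - r‖ + ‖s‖ := norm_sub_le _ _
        _ ≤ ‖p + q‖ + ‖r‖ + ‖s‖ := by gcongr; exact norm_sub_le _ _
        _ ≤ ‖p‖ + ‖q‖ + ‖r‖ + ‖s‖ := by gcongr; exact norm_add_le _ _
    have hA1 := hB (imgKer n μ lam ((fun j => ((a j : ℕ) : ℤ)) + (n : ℤ) • y)) (imgKer n ν lam ((fun j => ((a j : ℕ) : ℤ)) + (n : ℤ) • y + unitVec μ))
      (imgKer n μ lam ((fun j => ((a j : ℕ) : ℤ)) + (n : ℤ) • y + unitVec ν)) (imgKer n ν lam ((fun j => ((a j : ℕ) : ℤ)) + (n : ℤ) • y))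
    have hA2 := hB (imgKer n μ lam ((fun j => ((a j : ℕ) : ℤ)) + (n : ℤ) • y - unitVec ν))
      (imgKer n ν lam ((fun j => ((a j : ℕ) : ℤ)) + (n : ℤ) • y - unitVec ν + unitVec μ))
      (imgKer n μ lam ((fun j => ((a j : ℕ) : ℤ)) + (n : ℤ) • y - unitVec ν + unitVec ν)) (imgKer n ν lam ((fun j => ((a j : ℕ) : ℤ)) + (n : ℤ) • y - unitVec ν))
    linarith
  calc ‖kerCurl n μ lam ((fun j => ((a j : ℕ) : ℤ)) + (n : ℤ) • y)‖ ≤ ∑ ν : Fin (3 + 1), 8 * E := norm_sum_le_of_le _ fun ν _ => hterm ν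
    _ = (3 + 1 : ℕ) * (8 * (MG163 (3 + 1) * Real.exp (2 * kappa163 (3 + 1)))) * Real.exp (-(kappa163 (3 + 1) * supNorm y)) := by
        rw [Finset.sum_const, Finset.card_univ, Fintype.card_fin, nsmul_eq_mul, hE]; push_cast; ring

end Crude

/-! ## §3  ★★★ The four infinite-volume bounds -/

/-- The generic extraction step at the record: a real kernel `K(z) = Re 𝒦(a + n·z)` with crude decay, whose periodisation on every large volume is the value of a quantity
bounded by `B·e^{−δ|z|_∞}`, obeys `‖K z‖ ≤ B·e^{−δ|z|_∞}`. [cite: Balaban1984PropagatorsI, p.36 ll.20–23 (ours)] -/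
theorem norm_le_of_rows {k : ℕ} (K : (Fin (3 + 1) → ℤ) → ℂ) {Mc : ℝ} (hK : ∀ y, ‖K y‖ ≤ Mc * Real.exp (-(kappa163 (3 + 1) * supNorm y)))
    (z : Fin (3 + 1) → ℤ) {B : ℝ}
    (hreal : ∀ (K' : ℕ) (hk2 : k + 1 + 1 ≤ (F.P K').m + (F.P K').K), (∀ i, 2 * |z i| ≤ Mk (F.P K') (k + 1) i) →
      ‖∑' m : Fin (3 + 1) → ℤ, K (translate (Mk (F.P K') (k + 1)) z m)‖ ≤ B) :
    ‖K z‖ ≤ B := by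
  obtain ⟨C, _, hC⟩ := exists_tailConst 3 (kappa163_pos (3 + 1))
  refine norm_le_of_forall_periodise_le (kappa163_pos (3 + 1)) hC K hK z fun t => ?_
  -- a volume whose coarse torus exceeds both `t` and `2|z|_∞`
  obtain ⟨i₀, hi₀⟩ := exists_supNorm_eq z
  obtain ⟨K', hk2, hN⟩ := exists_volume_ge F k (t + (2 * |z i₀|).toNat)
  have hN' : ∀ i, t + 1 ≤ Mk (F.P K') (k + 1) i := fun i => by
    show t + 1 ≤ (F.P K').sitesPerDir (k + 1); omega
  have hz : ∀ i, 2 * |z i| ≤ Mk (F.P K') (k + 1) i := by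
    intro i
    show 2 * |z i| ≤ (((F.P K').sitesPerDir (k + 1) : ℕ) : ℤ)
    have h1 : ((|z i| : ℤ) : ℝ) ≤ ((|z i₀| : ℤ) : ℝ) := by rw [← hi₀]; exact abs_le_supNorm z i
    have h1' : |z i| ≤ |z i₀| := by exact_mod_cast h1
    have h2 : (2 * |z i₀| : ℤ) ≤ ((2 * |z i₀|).toNat : ℤ) := Int.self_le_toNat _
    have h3 : ((t + (2 * |z i₀|).toNat + 1 : ℕ) : ℤ) ≤ (((F.P K').sitesPerDir (k + 1) : ℕ) : ℤ) := by exact_mod_cast hN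
    push_cast at h3
    linarith
  exact ⟨Mk (F.P K') (k + 1), hN', hz, hreal K' hk2 hz⟩

/-- ★★★ **THE INFINITE-VOLUME VALUE KERNEL DECAYS**: `|Re imgKer n μ λ (a + n·z)| ≤ MG163(4)·periodConst(κ₁₆₃(4), 3)·e^{−(κ₁₆₃(4)∕4)|z|_∞}` (the `4` printed `(3 : ℕ) + 1` as in the row) for every `k` (`n = L^{k+1}`, written at
a reference volume `K₀`, of which it is independent), offset `a`, directions `μ, λ`, `z ∈ ℤ⁴` — extracted from ✓`norm_windowResp_univ_le` on the volumes `K → ∞`.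
[cite: Balaban1984PropagatorsI, (1.63) p.28, (1.65) p.29, p.36 ll.20–23] -/
theorem norm_re_imgKer_le (K₀ k : ℕ) (a : Fin (3 + 1) → Fin ((F.P K₀).L ^ (k + 1))) (μ lam : Fin (3 + 1)) (z : Fin (3 + 1) → ℤ) :
    ‖(((imgKer ((F.P K₀).L ^ (k + 1)) μ lam ((fun j => ((a j : ℕ) : ℤ)) + (((F.P K₀).L ^ (k + 1) : ℕ) : ℤ) • z)).re : ℝ) : ℂ)‖ ≤
      MG163 4 * periodConst (kappa163 4) 3 * Real.exp (-(kappa163 4 / (((3 : ℕ) : ℝ) + 1) * supNorm z)) := by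
  refine norm_le_of_rows (F := F) (k := k)
    (fun z => (((imgKer ((F.P K₀).L ^ (k + 1)) μ lam ((fun j => ((a j : ℕ) : ℤ)) + (((F.P K₀).L ^ (k + 1) : ℕ) : ℤ) • z)).re : ℝ) : ℂ))
    (norm_re_imgKer_crude ((F.P K₀).L ^ (k + 1)) μ lam a) z fun K' hk2 hz => ?_
  obtain ⟨x, hx, hdist⟩ := realised_config (F := F) hk2 a z hz
  have hk : k + 1 ≤ (F.P K').m + (F.P K').K := Nat.le_of_succ_le hk2
  -- the value of the response at the realised configuration IS the periodisation at `z`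
  have hval := windowResp_univ_eq_re_tsum F hk lam (0 : Site (F.P K') (k + 1)) x μ
    ((fun j => ((a j : ℕ) : ℤ)) + (((F.P K').L ^ (k + 1) : ℕ) : ℤ) • z) 0 (by rw [add_zero]; exact hx)
  have hsum := summable_imgKer_translate_record F (K := K') (k := k) lam (0 : Site (F.P K') (k + 1)) μ
    ((fun j => ((a j : ℕ) : ℤ)) + (((F.P K').L ^ (k + 1) : ℕ) : ℤ) • z) 0 abs_zero_step_le
  rw [rep_zero_site', add_zero] at hval hsum
  have hsum' : Summable fun m : Fin (3 + 1) → ℤ =>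
      imgKer ((F.P K').L ^ (k + 1)) μ lam ((fun j => ((a j : ℕ) : ℤ)) + (((F.P K').L ^ (k + 1) : ℕ) : ℤ) • translate (Mk (F.P K') (k + 1)) z m) :=
    hsum.congr fun m => by rw [translate_fine_offset]
  have hper : ∑' m : Fin (3 + 1) → ℤ, (((imgKer ((F.P K').L ^ (k + 1)) μ lam
      ((fun j => ((a j : ℕ) : ℤ)) + (((F.P K').L ^ (k + 1) : ℕ) : ℤ) • translate (Mk (F.P K') (k + 1)) z m)).re : ℝ) : ℂ) =
      ((windowResp F k K' Finset.univ (lam, (0 : Site (F.P K') (k + 1))) ⟨x, μ⟩ : ℝ) : ℂ) := by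
    rw [hval, periodise_re (K := fun z' => imgKer ((F.P K').L ^ (k + 1)) μ lam
      ((fun j => ((a j : ℕ) : ℤ)) + (((F.P K').L ^ (k + 1) : ℕ) : ℤ) • z')) (N := Mk (F.P K') (k + 1)) (x := z) hsum']
    congr 2
    exact tsum_congr fun m => by rw [translate_fine_offset]
  have hrow := norm_windowResp_univ_le F hk (lam, (0 : Site (F.P K') (k + 1))) ⟨x, μ⟩
  dsimp only at hrow
  rw [hdist] at hrow
  have hfinal : ‖((windowResp F k K' Finset.univ (lam, (0 : Site (F.P K') (k + 1))) ⟨x, μ⟩ : ℝ) : ℂ)‖ ≤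
      MG163 4 * periodConst (kappa163 4) 3 * Real.exp (-(kappa163 4 / (((3 : ℕ) : ℝ) + 1) * supNorm z)) := by
    rw [Complex.norm_real, Real.norm_eq_abs]
    exact hrow
  exact (le_of_eq (congrArg _ hper)).trans hfinal

end Summit.QuantumFields.YangMills.Theorems.PortU8.Images

end
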